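import Summits.ValiantsHypothesis.ValiantsHypothesis.Theorems.ProjectionStabilityOptStepTwoSidedTorusChain
import Literature.Computability.AlgebraicComplexity.LandsbergRessayreProofs
import Mathlib.Data.Nat.Choose.Sum
import HarnessLib

/-!
# Two-sided-torus lower bound for `per_m` — III: weights over `2m` primes and the restricted pencils

Support file for crux `ProjectionStability.OptStep` (stmt-ValiantsHypothesis-17835), line `Sketch`,
stub K2 `stub_twoSidedTorus_lower` (file IV, `ProjectionStabilityOptStepStubTwoSidedTorusLower.lean`).

* weights `γ₀ ∏ P_i^{U_i}` over `2m` distinct primes are injective in `U` (`mul_prod_pow_injective`),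
  and the weight `γ₀ ∏_k (p_k q_{π k})^{u_k}` of the `π`-restricted pencil is the `2m`-prime weight
  of the pair `(u, u ∘ π⁻¹)` (`prod_pair_pow_eq_append`);
* `exists_isTop`: for `g Λ = Λ h` with `dim ker Λ = 1`, all generalised eigenspaces of `g` but one
  lie in `range Λ` (file II's `exists_top` at the matrix level);
* `restricted_facts` (= registered helper stub `stub_genTorus_restricted`): for the restricted
  pencil `Λ + Σ_k y_k A_{k,π k}` with an invertible member and injective weights, there is an
  exponent `u ≠ 0` of top weight and, below it, weights of every support size `≤ |supp u|`, all
  with non-zero generalised eigenspace of `g` (files I, II applied to the exact lift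
  `liftOfMatrices` of the torus element restricted to the pencil);
* `sum_Ico_choose`: `Σ_{1 ≤ s < m} C(m,s) = 2^m − 2`.

## References
* J. M. Landsberg, N. Ressayre, arXiv:1508.05788, §6 (method).
-/

noncomputable section

set_option linter.dupNamespace false

namespace Summit.ValiantsHypothesis.ValiantsHypothesis.Theorems.ProjectionStabilityOptStep.TwoSidedTorusRestricted

open Matrix MvPolynomial Finset Submodule Module.End
open Literature.Computability.AlgebraicComplexity LRPencil
open Summit.ValiantsHypothesis.ValiantsHypothesis.Theorems.ProjectionStabilityOptStep

/-! ### Weights over `2m` primes -/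

section Weights

variable {n : ℕ}

/-- Unique factorisation with a unit: `U ↦ γ₀ ∏ P_i^{U_i}` is injective for distinct primes `P_i`
and `γ₀ ≠ 0`. [folklore] -/
theorem mul_prod_pow_injective (P : Fin n → ℕ) (hP : ∀ i, (P i).Prime) (hPinj : Function.Injective P)
    {γ₀ : ℂ} (hγ₀ : γ₀ ≠ 0) :
    Function.Injective fun U : Fin n → ℕ => γ₀ * ∏ i, (P i : ℂ) ^ U i := by
  intro U U' h
  have h' : (∏ i, (P i : ℂ) ^ U i) = ∏ i, (P i : ℂ) ^ U' i := mul_left_cancel₀ hγ₀ h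
  apply TorusGrading.eq_of_prod_prime_pow_eq hP hPinj
  exact_mod_cast h'

/-- `Fin.append` is injective in the pair. [folklore] -/
theorem append_inj {α : Type*} {a b : ℕ} {u u' : Fin a → α} {v v' : Fin b → α}
    (h : Fin.append u v = Fin.append u' v') : u = u' ∧ v = v' := by
  constructor
  · funext i
    have := congrFun h (Fin.castAdd b i)
    rwa [Fin.append_left, Fin.append_left] at this
  · funext j
    have := congrFun h (Fin.natAdd a j)
    rwa [Fin.append_right, Fin.append_right] at this

/-- The weight of the `π`-restricted pencil is the `2m`-prime weight of the pair
`(u, u ∘ π⁻¹)` (rows used, columns used). [folklore] -/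
theorem prod_pair_pow_eq {m : ℕ} (d e : Fin m → ℂ) (π : Equiv.Perm (Fin m)) (u : Fin m → ℕ) :
    (∏ k, (d k * e (π k)) ^ u k) =
      (∏ k, d k ^ u k) * ∏ j, e j ^ (u ∘ ⇑π.symm) j := by
  calc (∏ k, (d k * e (π k)) ^ u k) = ∏ k, (d k ^ u k * e (π k) ^ u k) :=
        prod_congr rfl fun k _ => mul_pow _ _ _
    _ = (∏ k, d k ^ u k) * ∏ k, e (π k) ^ u k := prod_mul_distrib
    _ = (∏ k, d k ^ u k) * ∏ j, e j ^ (u ∘ ⇑π.symm) j := by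
        congr 1
        exact Fintype.prod_equiv π (fun k => e (π k) ^ u k) (fun j => e j ^ (u ∘ ⇑π.symm) j)
          (fun k => by simp)

/-- … written over `Fin (m + m)` with `Fin.append`. [folklore] -/
theorem prod_pair_pow_eq_append {m : ℕ} (P : Fin (m + m) → ℕ) (π : Equiv.Perm (Fin m)) (u : Fin m → ℕ) :
    (∏ k, ((P (Fin.castAdd m k) : ℂ) * (P (Fin.natAdd m (π k)) : ℂ)) ^ u k) =
      ∏ i, (P i : ℂ) ^ (Fin.append u (u ∘ ⇑π.symm)) i := by
  rw [prod_pair_pow_eq (fun k => (P (Fin.castAdd m k) : ℂ)) (fun j => (P (Fin.natAdd m j) : ℂ)) π u,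
    Fin.prod_univ_add]
  simp only [Fin.append_left, Fin.append_right]

end Weights

/-! ### The restricted pencil of a permutation -/

section Restricted

variable {m N : ℕ}

/-- One diagonal substitution on coefficient matrices: `Σ_i diag(c)_{w i} • B_i = c_w • B_w`. [folklore] -/
theorem sum_diagonal_smul {ι M : Type*} [Fintype ι] [DecidableEq ι] [AddCommMonoid M] [Module ℂ M]
    (c : ι → ℂ) (B : ι → M) (w : ι) :
    ∑ i, (Matrix.diagonal c) w i • B i = c w • B w := by
  rw [sum_eq_single w]
  · rw [Matrix.diagonal_apply_eq]
  · intro i _ hi; rw [Matrix.diagonal_apply_ne _ (Ne.symm hi), zero_smul]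
  · intro h; exact absurd (mem_univ w) h

/-- **The top weight exists** (regularity): for matrices `g, h ∈ GL_N` with `g Λ = Λ h` and
`dim ker Λ = 1`, all generalised eigenspaces of `g` but one lie in `range Λ`. [cite: LandsbergRessayre2017, §6] -/
theorem exists_isTop (Λm : Matrix (Fin N) (Fin N) ℂ) (g h : GL (Fin N) ℂ)
    (hΛ : (g : Matrix (Fin N) (Fin N) ℂ) * Λm = Λm * (h : Matrix (Fin N) (Fin N) ℂ))
    (hK : Module.finrank ℂ (LinearMap.ker (Matrix.toLin' Λm)) = 1) :
    ∃ βt : ℂ, ∀ β, β ≠ βt →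
      maxGenEigenspace (Matrix.toLin' (g : Matrix (Fin N) (Fin N) ℂ)) β ≤ LinearMap.range (Matrix.toLin' Λm) := by
  -- the lift of the ZERO pencil in `m = 0` variables only needs `g Λ = Λ h`
  let L : Lift (Matrix.toLin' Λm) (fun k j : Fin 0 => Matrix.toLin' ((fun _ _ => (0 : Matrix (Fin N) (Fin N) ℂ)) k j))
      1 (fun _ => (1 : ℂ)) :=
    liftOfMatrices Λm (fun _ _ => 0) 1 (fun _ => 1) (fun _ => one_ne_zero) g h hΛ
      (fun k _ => k.elim0)
  exact GenTorus.exists_top L hK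

/-- **Facts about the `π`-restricted pencil** `Λ + Σ_k y_k A_{k, π k}`: given the lift `(g, h)` of a
torus element with multipliers `c k j` on `A_{kj}`, the eigenvalue `γ₀` of `h` on the line `ker Λ`,
an invertible member of the restricted pencil and injectivity of the weights
`wt u = γ₀ ∏_k c_{k,π k}^{u_k}`: there is an exponent `u ≠ 0` of TOP weight, and below it weights of
every support size `1 ≤ s ≤ |supp u|`, all with non-zero generalised eigenspace of `g`.
[cite: LandsbergRessayre2017, §6] -/
theorem restricted_facts (Λm : Matrix (Fin N) (Fin N) ℂ) (Am : Fin m → Fin m → Matrix (Fin N) (Fin N) ℂ)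
    (g h : GL (Fin N) ℂ) (hΛ : (g : Matrix (Fin N) (Fin N) ℂ) * Λm = Λm * (h : Matrix (Fin N) (Fin N) ℂ))
    (c : Fin m → Fin m → ℂ) (hc : ∀ k j, c k j ≠ 0)
    (hAt : ∀ k j, (g : Matrix (Fin N) (Fin N) ℂ) * Am k j = c k j • (Am k j * (h : Matrix (Fin N) (Fin N) ℂ)))
    (γ₀ : ℂ) (hγker : LinearMap.ker (Matrix.toLin' Λm) ≤
      maxGenEigenspace (Matrix.toLin' (h : Matrix (Fin N) (Fin N) ℂ)) γ₀)
    (hK0 : LinearMap.ker (Matrix.toLin' Λm) ≠ ⊥) (π : Equiv.Perm (Fin m))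
    (hwinj : Function.Injective fun u : Fin m → ℕ => γ₀ * ∏ k, c k (π k) ^ u k)
    (hgen : ∃ x : Fin m → Fin m → ℂ, Function.Injective
      (Matrix.toLin' Λm + ∑ k, ∑ j, x k j • Matrix.toLin' (if j = π k then Am k j else 0)))
    {βt : ℂ} (hβt : ∀ β, β ≠ βt →
      maxGenEigenspace (Matrix.toLin' (g : Matrix (Fin N) (Fin N) ℂ)) β ≤ LinearMap.range (Matrix.toLin' Λm)) :
    ∃ u : Fin m → ℕ, u ≠ 0 ∧ γ₀ * ∏ k, c k (π k) ^ u k = βt ∧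
      ∀ s, 1 ≤ s → s ≤ (supp u).card → ∃ v : Fin m → ℕ, (supp v).card = s ∧
        maxGenEigenspace (Matrix.toLin' (g : Matrix (Fin N) (Fin N) ℂ)) (γ₀ * ∏ k, c k (π k) ^ v k) ≠ ⊥ := by
  classical
  set Aπ : Fin m → Fin m → Matrix (Fin N) (Fin N) ℂ := fun k j => if j = π k then Am k j else 0 with hAπdef
  have hAπ : ∀ k j, (g : Matrix (Fin N) (Fin N) ℂ) * Aπ k j =
      c k (π k) • (Aπ ((1 : Equiv.Perm (Fin m)) k) j * (h : Matrix (Fin N) (Fin N) ℂ)) := by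
    intro k j
    rw [Equiv.Perm.one_apply]
    by_cases hj : j = π k
    · simp only [Aπ, if_pos hj]; subst hj; exact hAt k (π k)
    · simp only [Aπ, if_neg hj, Matrix.mul_zero, Matrix.zero_mul, smul_zero]
  let L : Lift (Matrix.toLin' Λm) (fun k j => Matrix.toLin' (Aπ k j)) 1 (fun k => c k (π k)) :=
    liftOfMatrices Λm Aπ 1 (fun k => c k (π k)) (fun k => hc k (π k)) g h hΛ hAπ
  set wt : (Fin m → ℕ) → ℂ := fun u => γ₀ * ∏ k, c k (π k) ^ u k with hwtdef
  have hstep : ∀ (u : Fin m → ℕ) (k : Fin m), wt (u + Pi.single k 1) = c k (π k) * wt u := by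
    intro u k
    have h1 : (∏ i, c i (π i) ^ (u + Pi.single k 1 : Fin m → ℕ) i) =
        (∏ i, c i (π i) ^ u i) * c k (π k) := by
      have : (∏ i, c i (π i) ^ (u + Pi.single k 1 : Fin m → ℕ) i) =
          ∏ i, (c i (π i) ^ u i * c i (π i) ^ (Pi.single k 1 : Fin m → ℕ) i) :=
        prod_congr rfl fun i _ => by rw [Pi.add_apply, pow_add]
      rw [this, prod_mul_distrib]
      congr 1
      rw [prod_eq_single k (fun j _ hj => by rw [Pi.single_eq_of_ne hj, pow_zero]) (by simp)]
      simp
    simp only [wt]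
    rw [h1]; ring
  have hwt0 : wt 0 = γ₀ := by simp [wt]
  have hker : LinearMap.ker (Matrix.toLin' Λm) ≤ maxGenEigenspace (L.C : (Fin N → ℂ) →ₗ[ℂ] (Fin N → ℂ)) (wt 0) := by
    rw [hwt0]; exact hγker
  have hesc : ¬ canon (Matrix.toLin' Λm) (fun k j => Matrix.toLin' (Aπ k j)) univ ≤
      LinearMap.range (Matrix.toLin' Λm) :=
    not_canon_univ_le_range hK0 hgen
  obtain ⟨u, hu, hune⟩ := GenTorus.exists_wt_of_not_le_range L wt hwinj hstep hker hesc
  have hwtu : wt u = βt := GenTorus.wt_eq_of_not_le_range L wt hβt hune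
  have hgood : u ∈ U univ ∧ canon (Matrix.toLin' Λm) (fun k j => Matrix.toLin' (Aπ k j)) univ ⊓
      maxGenEigenspace (L.B : (Fin N → ℂ) →ₗ[ℂ] (Fin N → ℂ)) (wt u) ≠ ⊥ :=
    ⟨hu, fun h0 => hune (by rw [h0]; exact bot_le)⟩
  refine ⟨u, hu.1, hwtu, fun s hs1 hs => ?_⟩
  obtain ⟨v, -, hv, hvs⟩ :=
    GenTorus.exists_good_of_le_card_of_le L wt hwinj hstep hker _ u rfl hgood s hs1 hs
  exact ⟨v, hvs, fun h0 => hv.2 (by rw [eq_bot_iff, ← h0]; exact inf_le_right)⟩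

end Restricted

section Choose

/-- `Σ_{s ∈ [1, m)} C(m,s) = 2^m − 2`. [folklore] -/
theorem sum_Ico_choose (m : ℕ) (hm : 1 ≤ m) : ∑ s ∈ Ico 1 m, m.choose s = 2 ^ m - 2 := by
  have h := Nat.sum_range_choose m
  rw [Finset.range_eq_Ico, Finset.sum_Ico_succ_top (Nat.zero_le m), Nat.choose_self,
    Finset.sum_eq_sum_Ico_succ_bot (by omega : 0 < m), Nat.choose_zero_right] at h
  have h' : (∑ s ∈ Ico 1 m, m.choose s) + 2 = 2 ^ m := by rw [← h]; ring
  omega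

end Choose

/-! ### Export (registered helper stub of stmt-ValiantsHypothesis-17835) -/

/-- **The restricted-pencil facts, closed form** (registered helper stub `stub_genTorus_restricted`
of the crux item, = `restricted_facts`). [cite: LandsbergRessayre2017, §6] -/
theorem stub_genTorus_restricted : ∀ {m N : ℕ} (Λm : Matrix (Fin N) (Fin N) ℂ) (Am : Fin m → Fin m → Matrix (Fin N) (Fin N) ℂ) (g h : GL (Fin N) ℂ), (g : Matrix (Fin N) (Fin N) ℂ) * Λm = Λm * (h : Matrix (Fin N) (Fin N) ℂ) → ∀ (c : Fin m → Fin m → ℂ), (∀ k j, c k j ≠ 0) → (∀ k j, (g : Matrix (Fin N) (Fin N) ℂ) * Am k j = c k j • (Am k j * (h : Matrix (Fin N) (Fin N) ℂ))) → ∀ (γ₀ : ℂ), LinearMap.ker (Matrix.toLin' Λm) ≤ Module.End.maxGenEigenspace (Matrix.toLin' (h : Matrix (Fin N) (Fin N) ℂ)) γ₀ → LinearMap.ker (Matrix.toLin' Λm) ≠ ⊥ → ∀ (π : Equiv.Perm (Fin m)), (Function.Injective fun u : Fin m → ℕ => γ₀ * ∏ k, c k (π k) ^ u k) → (∃ x :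 Fin m → Fin m → ℂ, Function.Injective (Matrix.toLin' Λm + ∑ k, ∑ j, x k j • Matrix.toLin' (if j = π k then Am k j else 0))) → ∀ {βt : ℂ}, (∀ β, β ≠ βt → Module.End.maxGenEigenspace (Matrix.toLin' (g : Matrix (Fin N) (Fin N) ℂ)) β ≤ LinearMap.range (Matrix.toLin' Λm)) → ∃ u : Fin m → ℕ, u ≠ 0 ∧ γ₀ * ∏ k, c k (π k) ^ u k = βt ∧ ∀ s, 1 ≤ s → s ≤ (LRPencil.supp u).card → ∃ v : Fin m → ℕ, (LRPencil.supp v).card = s ∧ Module.End.maxGenEigenspace (Matrix.toLin' (g : Matrix (Fin N) (Fin N) ℂ)) (γ₀ * ∏ k, c k (π k) ^ v k) ≠ ⊥ :=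
  by
  intro m N Λm Am g h hΛ c hc hAt γ₀ hγker hK0 π hwinj hgen βt hβt
  exact restricted_facts Λm Am g h hΛ c hc hAt γ₀ hγker hK0 π hwinj hgen hβt

end Summit.ValiantsHypothesis.ValiantsHypothesis.Theorems.ProjectionStabilityOptStep.TwoSidedTorusRestricted
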